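import Summits.BirchSwinnertonDyer.BirchSwinnertonDyer.Theorems.EisensteinPrimesLcongrAtLevelOne
import Mathlib.LinearAlgebra.Dimension.FreeAndStrongRankCondition
import Mathlib.LinearAlgebra.LinearIndependent.Lemmas
import HarnessLib

/-!
# The `ρ = 1` LAW and the `ρ = 2` PENCIL as kernel algebra, with the SOCKET to `λ` / `lcongr(1)` over
# `Λ = ℤ_p⟦T⟧` (cell `bsd-eis`, seat `bsd-line-x2-p2`, D-0154 KEY row 5; route `EisensteinPrimes`,
# crux 4 `BSDpOnCellC` stmt-BirchSwinnertonDyer-19034 line b1 v10 / crux 3 `MazurMCOnCellB`;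
# RULING L98 (b) of planner g26 = the micro-target left open by `bsd-eis-cgshw` g21; memo
# `HOME/cgshw-MEMO-24.md` §1 (a)–(d))

HONEST FRAMING (cell `bsd-eis`, run/shared/lean/pub/bsd-eis/): pure linear algebra over a field and
pure commutative algebra of `Λ = ℤ_p⟦T⟧`, everything PROVED (Mathlib + the tree's `X1.MuLambda` /
`Supersingular.MazurTateReduction` / `LcongrAtLevelOne` API); NO modular symbol, Hecke algebra,
`L`-function or Hida family is constructed or asserted; nothing is booked; X2 stays
CONSTRUCTION-SHAPED; no label or count moves; BSD and Mazur's main conjecture are proved for no curve.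

## The point

MEMO-24 §1 (a) reads `λ(g) = ord_T L̄(φ̄_g)` for every `μ`-primitive ordinary `𝔪`-form `g`, with
`L̄ : 𝒦⁺ → 𝔽_p⟦T⟧` ONE linear map (mod-`p` Mazur–Tate transform) on ONE `𝔽_p`-space (mod-`p`
`𝔪`-torsion symbols), `ρ := rank L̄`. Its two structural consequences — «`ρ = 1` ⇒ `λ` RIGID over
the whole Hecke algebra» (§1 (a)) and «on a β-branch the member's symbol runs through the pencil
`Ψ̄ + jΞ̄`, `j = (k − 2) mod p`, so `λ(g_k)` is generic off at most one residue, and a `λ`-jump forces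
`ρ ≥ 2`» (§1 (b)(iii), (c)) — are LINEAR ALGEBRA about the `T`-order on a subspace of `F⟦T⟧`.
§1–§2 prove them in that generality; §3 plugs them into the tree's `μ`/`λ`/`red` of `Λ` and the
single-level door's `lcongr` at `m = 1`, with the memo's modular inputs — the INTERPOLATION
`red L_p(g) = L̄(φ̄_g)`, `μ`-PRIMITIVITY `L̄(φ̄_g) ≠ 0` and the RANK of `L̄` — as hypotheses on
abstract data (`K`, `MT : K →ₗ 𝔽_p⟦T⟧`, `φE φg : K`).

* §1 `order_smul_of_ne_zero`; `order_eq_order_of_rank_le_one`; **`order_apply_eq_of_rank_range_le_one`**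
  (THE `ρ = 1` LAW: `rank (range M) ≤ 1` ⇒ `ord ∘ M` constant on `K ∖ ker M`; menu a subsingleton);
  `exists_order_gt_of_linearIndependent` (a plane carries ≥ 2 orders); `rank_le_one_iff_order_eq_order`
  («the menu is ONE number iff `ρ ≤ 1`»).
* §2 `min_order_pencil_le_order` (two distinct members of `A + j·B` bound the plane from below);
  `not_order_lt_and_order_lt_pencil` (AT MOST ONE special member); `linearIndependent_of_order_pencil_ne`
  (an order jump between non-zero members forces `A, B` independent: «a `λ`-jump needs `ρ ≥ 2`»).
* §3 `mu_eq_zero_and_lam_eq_order_of_red_eq`, `one_le_mu_of_red_eq_of_apply_eq_zero`,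
  `mu_eq_zero_iff_apply_ne_zero` (`μ`, `λ` read on the symbol); **`lam_eq_lam_of_rank_range_le_one`**
  (`ρ ≤ 1` + interpolation + primitivity ⇒ `λ(L_g) = λ(L_E)`); **`lcongr_one_of_rank_range_le_one`**
  (⇒ `(L_g) + (p) = (L_E) + (p)`, via p558610); `min_lam_pencil_le_lam` / `not_lam_lt_and_lam_lt_pencil`
  / `mu_eq_zero_pencil` (β-branch law: `red (L j) = A + j·B ≠ 0` ⇒ `λ(L j)` minimal off ≤ 1 residue).

What this is NOT: not a construction of `𝒦⁺`, `L̄`, any symbol or `p`-adic `L`-function; the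
interpolation identities, the non-vanishing and the rank bound are INPUTS (memo: Greenberg–Stevens
(6.1), Hida / Ash–Stevens weight comparison, Emerton–Pollack–Weston's argument); the β-type clause
`Φ₀ ∈ 𝔪_Λ𝕎` of §1 (b)(iii) is beyond print and NOT asserted (§2/§3 are IF-statements about a
pencil of reductions). Not a proof of `lcongr` for any member, of any main conjecture, or of BSD.

References: [Washington1997] §7.1; [GreenbergVatsal2000] p. 2–3, (1)–(2); [EmertonPollackWeston2006]
Thm. 2 and Cor. 2 (the printed rank-one / Gorenstein case of `λ`-constancy along a Hida branch);
[GreenbergStevens1993] Prop. (6.1), p. 438; [Skinner2016PacificMC] §3.1 (p. 192).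
-/

set_option autoImplicit false
set_option linter.dupNamespace false

noncomputable section

open Literature.NumberTheory.EllipticCurves Summit.BirchSwinnertonDyer.Rank1Residual.X1.MuLambda
  Summit.BirchSwinnertonDyer.Rank2 Summit.BirchSwinnertonDyer.Rank1Residual.Supersingular
  Summit.BirchSwinnertonDyer.BirchSwinnertonDyer.Theorems.LcongrAtLevelOne

namespace Summit.BirchSwinnertonDyer.BirchSwinnertonDyer.Theorems.SymbolLineRigidity

/-! ## §1. Lines: the `T`-order is constant on `Fˣ·f`, hence on a rank-one subspace minus `0` -/

section Lines

variable {F : Type*} [Field F]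

/-- **The order of a power series over a field is homothety-invariant**: `ord(c·f) = ord f` for
`c ≠ 0` (`≥` is Mathlib's `le_order_smul`; `≤` from `f = c⁻¹·(c·f)`). [folklore] -/
theorem order_smul_of_ne_zero {c : F} (hc : c ≠ 0) (f : PowerSeries F) :
    (c • f).order = f.order := by
  refine le_antisymm ?_ PowerSeries.le_order_smul
  have h : f = c⁻¹ • (c • f) := by rw [smul_smul, inv_mul_cancel₀ hc, one_smul]
  calc (c • f).order ≤ (c⁻¹ • (c • f)).order := PowerSeries.le_order_smul
    _ = f.order := by rw [← h]

/-- **Rank one ⇒ one order (subspace form).** If a subspace `V ≤ F⟦T⟧` has rank `≤ 1` then all its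
non-zero elements have the same `T`-order: `V ≤ F·f₀` and `ord(a·f₀) = ord f₀` for `a ≠ 0`.
[folklore] -/
theorem order_eq_order_of_rank_le_one {V : Submodule F (PowerSeries F)}
    (hρ : Module.rank F V ≤ 1) {f g : PowerSeries F} (hf : f ∈ V) (hg : g ∈ V) (hf0 : f ≠ 0)
    (hg0 : g ≠ 0) : f.order = g.order := by
  obtain ⟨f₀, -, hle⟩ := (rank_submodule_le_one_iff V).mp hρ
  obtain ⟨a, rfl⟩ := Submodule.mem_span_singleton.mp (hle hf)
  obtain ⟨b, rfl⟩ := Submodule.mem_span_singleton.mp (hle hg)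
  have ha : a ≠ 0 := by rintro rfl; exact hf0 (zero_smul F f₀)
  have hb : b ≠ 0 := by rintro rfl; exact hg0 (zero_smul F f₀)
  rw [order_smul_of_ne_zero ha, order_smul_of_ne_zero hb]

variable {K : Type*} [AddCommGroup K] [Module F K]

/-- **THE `ρ = 1` LAW (memo §1 (a), kernel form).** For a linear `M : K → F⟦T⟧` («mod-`p`
Mazur–Tate transform on the `𝔪`-torsion symbol space») with `rank (range M) ≤ 1`, `ord_T ∘ M` is
CONSTANT on `K ∖ ker M` (no finiteness of `K` needed). [cite: EmertonPollackWeston2006, Thm. 2 and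
Cor. 2 (ρ̄ irreducible in EPW; cited for the shape — the printed rank-one case along a Hida branch)] -/
theorem order_apply_eq_of_rank_range_le_one (M : K →ₗ[F] PowerSeries F)
    (hρ : Module.rank F (LinearMap.range M) ≤ 1) {v w : K} (hv : M v ≠ 0) (hw : M w ≠ 0) :
    (M v).order = (M w).order :=
  order_eq_order_of_rank_le_one hρ (LinearMap.mem_range_self M v) (LinearMap.mem_range_self M w)
    hv hw

/-- **The menu is a subsingleton at `ρ ≤ 1`** (memo §1: `Λ(𝔪) := {ord_T L̄(v) : v ∈ 𝒦⁺, L̄(v) ≠ 0}`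
is ONE number when `ρ = 1`). [folklore] -/
theorem subsingleton_menu_of_rank_range_le_one (M : K →ₗ[F] PowerSeries F)
    (hρ : Module.rank F (LinearMap.range M) ≤ 1) :
    ((fun v => (M v).order) '' {v : K | M v ≠ 0}).Subsingleton := by
  rintro _ ⟨v, hv, rfl⟩ _ ⟨w, hw, rfl⟩
  exact order_apply_eq_of_rank_range_le_one M hρ hv hw

/-- **A plane carries two orders (converse of the `ρ = 1` law).** If `A, B ∈ F⟦T⟧` are independent,
some NON-ZERO `c·A + d·B` has order STRICTLY LARGER than `min (ord A) (ord B)` (kill the lowest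
coefficient): at `ρ ≥ 2` the menu has ≥ 2 values, special lines exist (memo §1 (a), (c)). [folklore] -/
theorem exists_order_gt_of_linearIndependent {A B : PowerSeries F}
    (h : LinearIndependent F ![A, B]) :
    ∃ c d : F, c • A + d • B ≠ 0 ∧ min A.order B.order < (c • A + d • B).order := by
  have hA : A ≠ 0 := by simpa using h.ne_zero 0
  have hne : ∀ c d : F, (c ≠ 0 ∨ d ≠ 0) → c • A + d • B ≠ 0 := fun c d hcd h0 => by
    obtain ⟨hc, hd⟩ := LinearIndependent.pair_iff.mp h c d h0
    rcases hcd with hcd | hcd <;> contradiction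
  rcases lt_trichotomy A.order B.order with hlt | heq | hgt
  · -- `ord A < ord B`: the member `B` itself is special
    exact ⟨0, 1, hne 0 1 (Or.inr one_ne_zero), by
      rwa [zero_smul, one_smul, zero_add, min_eq_left hlt.le]⟩
  · -- equal orders `n`: `b_n·A − a_n·B` kills the `T^n` coefficient
    set n := A.order.toNat
    have hAn : (A.order) = n := (PowerSeries.coe_toNat_order hA).symm
    have hBn : (B.order) = n := by rw [← heq, hAn]
    have ha : PowerSeries.coeff n A ≠ 0 := PowerSeries.coeff_order hA
    refine ⟨PowerSeries.coeff n B, -PowerSeries.coeff n A,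
      hne _ _ (Or.inr (neg_ne_zero.mpr ha)), ?_⟩
    rw [hAn, hBn, min_self]
    refine lt_of_lt_of_le (ENat.coe_lt_coe.mpr (Nat.lt_succ_self n)) (PowerSeries.nat_le_order _ _ ?_)
    intro i hi
    rcases Nat.lt_succ_iff_lt_or_eq.mp hi with hi | rfl
    · have hiA : PowerSeries.coeff i A = 0 :=
        PowerSeries.coeff_of_lt_order i (by rw [hAn]; exact_mod_cast hi)
      have hiB : PowerSeries.coeff i B = 0 :=
        PowerSeries.coeff_of_lt_order i (by rw [hBn]; exact_mod_cast hi)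
      simp [hiA, hiB]
    · simp [mul_comm]
  · -- `ord B < ord A`: the member `A` itself is special
    exact ⟨1, 0, hne 1 0 (Or.inl one_ne_zero), by
      rwa [one_smul, zero_smul, add_zero, min_eq_right hgt.le]⟩

/-- **«The menu is ONE number iff `ρ ≤ 1`»** (memo §1: `Λ(𝔪)` is one number iff `ρ = 1`): a subspace
`V ≤ F⟦T⟧` has `rank V ≤ 1` iff all its non-zero elements have the same `T`-order ((⇐): for `A ∈ V`
non-zero and `B ∈ V ∖ F·A`, `exists_order_gt_of_linearIndependent` gives two orders). [folklore] -/
theorem rank_le_one_iff_order_eq_order (V : Submodule F (PowerSeries F)) :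
    Module.rank F V ≤ 1 ↔
      ∀ f ∈ V, ∀ g ∈ V, f ≠ 0 → g ≠ 0 → f.order = g.order := by
  constructor
  · intro hρ f hf g hg hf0 hg0
    exact order_eq_order_of_rank_le_one hρ hf hg hf0 hg0
  · intro h
    rw [rank_submodule_le_one_iff]
    by_cases hbot : ∃ A ∈ V, A ≠ 0
    swap
    · refine ⟨0, V.zero_mem, fun f hf => ?_⟩
      have hf0 : f = 0 := by
        by_contra hf0
        exact hbot ⟨f, hf, hf0⟩
      rw [hf0]
      exact Submodule.zero_mem _
    obtain ⟨A, hAV, hA0⟩ := hbot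
    refine ⟨A, hAV, fun B hBV => ?_⟩
    by_contra hB
    have hind : LinearIndependent F ![A, B] := by
      rw [LinearIndependent.pair_iff' hA0]
      intro a ha
      exact hB (Submodule.mem_span_singleton.mpr ⟨a, ha⟩)
    obtain ⟨c, d, hne, hlt⟩ := exists_order_gt_of_linearIndependent hind
    have hmem : c • A + d • B ∈ V := V.add_mem (V.smul_mem c hAV) (V.smul_mem d hBV)
    have hB0 : B ≠ 0 := by simpa using hind.ne_zero 1
    have h1 : (c • A + d • B).order = A.order := (h A hAV _ hmem hA0 hne).symm
    have h2 : A.order = B.order := h A hAV B hBV hA0 hB0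
    rw [h1, ← h2, min_self] at hlt
    exact lt_irrefl _ hlt

end Lines

/-! ## §2. Pencils: `A + j·B` is generic off at most one member -/

section Pencil

variable {F : Type*} [Field F]

/-- **Two distinct members of a pencil control the plane.** For `j₁ ≠ j₂` every `c·A + d·B` has
`T`-order `≥ min (ord(A + j₁B)) (ord(A + j₂B))`: `B = (j₁ − j₂)⁻¹·((A + j₁B) − (A + j₂B))` and
`A = (A + j₁B) − j₁B` lie in the span of the two members. [folklore] -/
theorem min_order_pencil_le_order (A B : PowerSeries F) {j₁ j₂ : F} (hj : j₁ ≠ j₂) (c d : F) :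
    min (A + j₁ • B).order (A + j₂ • B).order ≤ (c • A + d • B).order := by
  set P₁ := A + j₁ • B with hP₁
  set P₂ := A + j₂ • B with hP₂
  have hB : B = (j₁ - j₂)⁻¹ • (P₁ - P₂) := by
    rw [hP₁, hP₂, add_sub_add_left_eq_sub, ← sub_smul, smul_smul,
      inv_mul_cancel₀ (sub_ne_zero.mpr hj), one_smul]
  have hA : A = P₁ - j₁ • B := by rw [hP₁, add_sub_cancel_right]
  have hcomb : c • A + d • B =
      (c - (c * j₁ - d) * (j₁ - j₂)⁻¹) • P₁ + ((c * j₁ - d) * (j₁ - j₂)⁻¹) • P₂ := by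
    rw [hA, hB]
    module
  rw [hcomb]
  exact (min_le_min PowerSeries.le_order_smul PowerSeries.le_order_smul).trans
    (PowerSeries.min_order_le_order_add _ _)

/-- **Each member is bounded below by any two OTHER distinct members.** [folklore] -/
theorem min_order_pencil_le_order_pencil (A B : PowerSeries F) {j₁ j₂ : F} (hj : j₁ ≠ j₂) (j : F) :
    min (A + j₁ • B).order (A + j₂ • B).order ≤ (A + j • B).order := by
  simpa only [one_smul] using min_order_pencil_le_order A B hj 1 j

/-- **AT MOST ONE SPECIAL MEMBER (memo §1 (b)(iii): `λ(g_k) = λ_j`, `j = (k − 2) mod p`, generic off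
one residue).** No member of the pencil `A + j·B` lies STRICTLY below two distinct other members;
equivalently, all members but at most one attain the minimal (generic) order. [folklore] -/
theorem not_order_lt_and_order_lt_pencil (A B : PowerSeries F) {j₁ j₂ : F} (hj : j₁ ≠ j₂) (j : F) :
    ¬ ((A + j • B).order < (A + j₁ • B).order ∧ (A + j • B).order < (A + j₂ • B).order) := by
  rintro ⟨h₁, h₂⟩
  exact (lt_min h₁ h₂).not_ge (min_order_pencil_le_order_pencil A B hj j)

/-- **A jump of order along the pencil forces independence («`ρ ≥ 2` is NECESSARY for a `λ`-jump»,
memo §1 (c)).** If two members `A + j₁B ≠ 0`, `A + j₂B ≠ 0` have DIFFERENT `T`-orders then `A, B`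
are linearly independent over `F` (were `B ∈ F·A` or `A ∈ F·B`, all non-zero members would be
non-zero multiples of one series, of equal order by §1). [folklore] -/
theorem linearIndependent_of_order_pencil_ne {A B : PowerSeries F} {j₁ j₂ : F}
    (h₁ : A + j₁ • B ≠ 0) (h₂ : A + j₂ • B ≠ 0) (hne : (A + j₁ • B).order ≠ (A + j₂ • B).order) :
    LinearIndependent F ![A, B] := by
  rw [LinearIndependent.pair_iff]
  intro s t hst
  by_contra hcontra
  apply hne
  by_cases ht : t = 0
  · -- `t = 0`, so `s ≠ 0` and `A = 0`: both members are non-zero multiples of `B`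
    have hs : s ≠ 0 := fun hs => hcontra ⟨hs, ht⟩
    rw [ht, zero_smul, add_zero] at hst
    have hA : A = 0 := by
      have := congrArg (fun x => s⁻¹ • x) hst
      simpa [smul_smul, inv_mul_cancel₀ hs] using this
    simp only [hA, zero_add] at h₁ h₂ ⊢
    have hj₁ : j₁ ≠ 0 := by rintro rfl; exact h₁ (zero_smul F B)
    have hj₂ : j₂ ≠ 0 := by rintro rfl; exact h₂ (zero_smul F B)
    rw [order_smul_of_ne_zero hj₁, order_smul_of_ne_zero hj₂]
  · -- `t ≠ 0`: `B = c • A` with `c = -(t⁻¹ s)`, so `A + jB = (1 + j c) • A`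
    have hB : B = (-(t⁻¹ * s)) • A := by
      have := congrArg (fun x => t⁻¹ • x) hst
      simp only [smul_add, smul_smul, inv_mul_cancel₀ ht, one_smul, smul_zero] at this
      rw [neg_smul, eq_neg_iff_add_eq_zero, add_comm]
      exact this
    have hmem : ∀ j : F, A + j • B = (1 + j * (-(t⁻¹ * s))) • A := by
      intro j
      rw [hB, smul_smul, add_smul, one_smul]
    rw [hmem j₁] at h₁
    rw [hmem j₂] at h₂
    rw [hmem j₁, hmem j₂]
    have hc₁ : (1 + j₁ * (-(t⁻¹ * s))) ≠ 0 := by rintro h; exact h₁ (by rw [h, zero_smul])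
    have hc₂ : (1 + j₂ * (-(t⁻¹ * s))) ≠ 0 := by rintro h; exact h₂ (by rw [h, zero_smul])
    rw [order_smul_of_ne_zero hc₁, order_smul_of_ne_zero hc₂]

end Pencil

/-! ## §3. Socket to `Λ = ℤ_p⟦T⟧`: `λ` and `lcongr(1)` from the mod-`p` symbol -/

section Socket

variable {p : ℕ} [Fact p.Prime]

variable {K : Type*} [AddCommGroup K] [Module (IsLocalRing.ResidueField ℤ_[p]) K]
  (MT : K →ₗ[IsLocalRing.ResidueField ℤ_[p]] PowerSeries (IsLocalRing.ResidueField ℤ_[p]))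

/-- **`μ` and `λ` read on the symbol.** If the reduction of `L ∈ Λ` is the transform of a vector,
`red L = MT φ`, and that transform is non-zero (the memo's «`μ`-primitive»), then `μ(L) = 0` and
`λ(L) = ord_T (MT φ)` (in `ℕ∞`). This is the tree's `Supersingular.mu_eq_zero_and_lam_eq_of_red_ne_zero`
with the interpolation identity substituted. [cite: GreenbergVatsal2000, p. 2–3, (1)–(2)] -/
theorem mu_eq_zero_and_lam_eq_order_of_red_eq {L : IwasawaAlgebra p} {φ : K} (hL : red L = MT φ)
    (hφ : MT φ ≠ 0) : mu L = 0 ∧ (lam L : ℕ∞) = (MT φ).order := by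
  have h := mu_eq_zero_and_lam_eq_of_red_ne_zero (g := L) (by rw [hL]; exact hφ)
  rw [hL] at h
  exact h

/-- **The kernel case: symbol in `ker MT` ⇒ `p ∣ L`** (memo §1 (a): a fully congruent form whose
symbol reduces into `ker L̄|_{𝒦⁺}` has `μ^{prim} ≥ 1`). [cite: Washington1997, §7.1] -/
theorem C_dvd_of_red_eq_of_apply_eq_zero {L : IwasawaAlgebra p} {φ : K} (hL : red L = MT φ)
    (hφ : MT φ = 0) : PowerSeries.C (p : ℤ_[p]) ∣ L := by
  rw [← red_eq_zero_iff, hL, hφ]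

/-- **The kernel case, `μ`-form**: with `L ≠ 0`, a symbol in `ker MT` gives `1 ≤ μ(L)`.
[cite: GreenbergVatsal2000, p. 2–3, (1)–(2)] -/
theorem one_le_mu_of_red_eq_of_apply_eq_zero {L : IwasawaAlgebra p} {φ : K} (hL0 : L ≠ 0)
    (hL : red L = MT φ) (hφ : MT φ = 0) : 1 ≤ mu L := by
  refine le_mu_of_C_pow_dvd hL0 ?_
  rw [pow_one]
  exact C_dvd_of_red_eq_of_apply_eq_zero MT hL hφ

/-- **`μ`-primitivity read on the symbol**: for `L ≠ 0` with `red L = MT φ`, `μ(L) = 0 ↔ MT φ ≠ 0`.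
[cite: GreenbergVatsal2000, p. 2–3, (1)–(2)] -/
theorem mu_eq_zero_iff_apply_ne_zero {L : IwasawaAlgebra p} {φ : K} (hL0 : L ≠ 0)
    (hL : red L = MT φ) : mu L = 0 ↔ MT φ ≠ 0 := by
  constructor
  · intro hμ hφ
    have := one_le_mu_of_red_eq_of_apply_eq_zero MT hL0 hL hφ
    omega
  · intro hφ
    exact (mu_eq_zero_and_lam_eq_order_of_red_eq MT hL hφ).1

/-- **THE `ρ = 1` LAW FOR `λ` (memo §1 (a): «if `ρ = 1` then EVERY fully congruent ordinary form
with `μ^{prim} = 0` has `λ(g) = λ(E)`»), kernel form.** Data: an `𝔽_p`-module `K` («`𝒦⁺`»), a linear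
`MT : K → 𝔽_p⟦T⟧` («`L̄`») with `rank (range MT) ≤ 1`, and `L_E, L_g ∈ Λ` with `red L_E = MT φE`,
`red L_g = MT φg` (INTERPOLATION) both non-zero (`μ`-PRIMITIVITY). Then `λ(L_g) = λ(L_E)`; all four
hypotheses are inputs. [cite: EmertonPollackWeston2006, Thm. 2 and Cor. 2 (ρ̄ irreducible in EPW; cited for the shape)]
[cite: GreenbergStevens1993, Prop. (6.1), p. 438] -/
theorem lam_eq_lam_of_rank_range_le_one
    (hρ : Module.rank (IsLocalRing.ResidueField ℤ_[p]) (LinearMap.range MT) ≤ 1)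
    {LE Lg : IwasawaAlgebra p} {φE φg : K} (hE : red LE = MT φE) (hg : red Lg = MT φg)
    (hE0 : MT φE ≠ 0) (hg0 : MT φg ≠ 0) : lam Lg = lam LE := by
  have h1 := (mu_eq_zero_and_lam_eq_order_of_red_eq MT hg hg0).2
  have h2 := (mu_eq_zero_and_lam_eq_order_of_red_eq MT hE hE0).2
  have h3 : (MT φg).order = (MT φE).order := order_apply_eq_of_rank_range_le_one MT hρ hg0 hE0
  exact_mod_cast (h1.trans (h3.trans h2.symm))

/-- **Both sides are `μ`-primitive and share `λ`** — the conjunction the level-one door criterion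
consumes. [cite: EmertonPollackWeston2006, Thm. 2 and Cor. 2 (ρ̄ irreducible in EPW; cited for the shape)] -/
theorem mu_eq_zero_and_lam_eq_lam_of_rank_range_le_one
    (hρ : Module.rank (IsLocalRing.ResidueField ℤ_[p]) (LinearMap.range MT) ≤ 1)
    {LE Lg : IwasawaAlgebra p} {φE φg : K} (hE : red LE = MT φE) (hg : red Lg = MT φg)
    (hE0 : MT φE ≠ 0) (hg0 : MT φg ≠ 0) : mu Lg = 0 ∧ mu LE = 0 ∧ lam Lg = lam LE :=
  ⟨(mu_eq_zero_and_lam_eq_order_of_red_eq MT hg hg0).1,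
    (mu_eq_zero_and_lam_eq_order_of_red_eq MT hE hE0).1,
    lam_eq_lam_of_rank_range_le_one MT hρ hE hg hE0 hg0⟩

/-- **`ρ = 1` ⇒ the single-level door's `lcongr` at `m = 1`** (memo §1 (d)), in the spelling of
`X2.CongruentMemberData.lcongr`: `(L_g) + (p)^1 = (L_E) + (p)^1` — `lam_eq_lam_of_rank_range_le_one`
composed with `LcongrAtLevelOne.lcongr_one_of_mu_eq_zero_of_lam_eq` (p558610).
[cite: Washington1997, §7.1] [cite: Skinner2016PacificMC, §3.1 (p. 192)] -/
theorem lcongr_one_of_rank_range_le_one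
    (hρ : Module.rank (IsLocalRing.ResidueField ℤ_[p]) (LinearMap.range MT) ≤ 1)
    {LE Lg : IwasawaAlgebra p} {φE φg : K} (hE : red LE = MT φE) (hg : red Lg = MT φg)
    (hE0 : MT φE ≠ 0) (hg0 : MT φg ≠ 0) :
    Ideal.span ({Lg} : Set (IwasawaAlgebra p)) ⊔
        (Ideal.span {(PowerSeries.C (p : ℤ_[p]) : IwasawaAlgebra p)}) ^ 1 =
      Ideal.span ({LE} : Set (IwasawaAlgebra p)) ⊔
        (Ideal.span {(PowerSeries.C (p : ℤ_[p]) : IwasawaAlgebra p)}) ^ 1 := by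
  obtain ⟨hμg, hμE, hlam⟩ := mu_eq_zero_and_lam_eq_lam_of_rank_range_le_one MT hρ hE hg hE0 hg0
  have hLg : Lg ≠ 0 := by rintro rfl; exact hg0 (by rw [← hg]; simp [red])
  have hLE : LE ≠ 0 := by rintro rfl; exact hE0 (by rw [← hE]; simp [red])
  exact lcongr_one_of_mu_eq_zero_of_lam_eq hLg hLE hμg hμE hlam

variable (L : IsLocalRing.ResidueField ℤ_[p] → IwasawaAlgebra p)
  (A B : PowerSeries (IsLocalRing.ResidueField ℤ_[p]))

/-- **The β-branch law for `λ` (memo §1 (b)(iii)), kernel form.** If `L j ∈ Λ` (indexed by the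
residue field) have reductions on a PENCIL, `red (L j) = A + j·B`, all non-zero, then for `j₁ ≠ j₂`
and every `j`: `min (λ(L j₁)) (λ(L j₂)) ≤ λ(L j)`. (IF-statement: that a Hida branch's member
symbols run through such a pencil — the `Φ₀ ∈ 𝔪_Λ𝕎` clause — is NOT asserted.)
[cite: GreenbergStevens1993, Prop. (6.1), p. 438] -/
theorem min_lam_pencil_le_lam (hred : ∀ j, red (L j) = A + j • B)
    (hne : ∀ j : IsLocalRing.ResidueField ℤ_[p], A + j • B ≠ 0)
    {j₁ j₂ : IsLocalRing.ResidueField ℤ_[p]} (hj : j₁ ≠ j₂) (j : IsLocalRing.ResidueField ℤ_[p]) :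
    min (lam (L j₁)) (lam (L j₂)) ≤ lam (L j) := by
  have hlam : ∀ i, (lam (L i) : ℕ∞) = (A + i • B).order := fun i => by
    have h := mu_eq_zero_and_lam_eq_of_red_ne_zero (g := L i) (by rw [hred i]; exact hne i)
    rw [hred i] at h
    exact h.2
  have h := min_order_pencil_le_order_pencil A B hj j
  rw [← hlam j₁, ← hlam j₂, ← hlam j] at h
  rcases le_total (lam (L j₁)) (lam (L j₂)) with hle | hle
  · rw [min_eq_left hle]
    rw [min_eq_left (ENat.coe_le_coe.mpr hle)] at h
    exact ENat.coe_le_coe.mp h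
  · rw [min_eq_right hle]
    rw [min_eq_right (ENat.coe_le_coe.mpr hle)] at h
    exact ENat.coe_le_coe.mp h

/-- **At most one special residue** (memo §1 (b)(iii): «`λ = 4 ⟺ k ≡ 2 (mod 3)`, else `2`» has the
only possible shape): under the hypotheses of `min_lam_pencil_le_lam`, no residue has `λ` strictly
below two distinct other residues. [cite: GreenbergStevens1993, Prop. (6.1), p. 438] -/
theorem not_lam_lt_and_lam_lt_pencil (hred : ∀ j, red (L j) = A + j • B)
    (hne : ∀ j : IsLocalRing.ResidueField ℤ_[p], A + j • B ≠ 0)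
    {j₁ j₂ : IsLocalRing.ResidueField ℤ_[p]} (hj : j₁ ≠ j₂) (j : IsLocalRing.ResidueField ℤ_[p]) :
    ¬ (lam (L j) < lam (L j₁) ∧ lam (L j) < lam (L j₂)) := by
  rintro ⟨h₁, h₂⟩
  exact (lt_min h₁ h₂).not_ge (min_lam_pencil_le_lam L A B hred hne hj j)

/-- **Every member is `μ`-primitive on a pencil of non-zero members** (memo §1 (b)(iii): «in the
primitive normalisation every member has `μ = 0`»). [cite: GreenbergVatsal2000, p. 2–3, (1)–(2)] -/
theorem mu_eq_zero_pencil (hred : ∀ j, red (L j) = A + j • B)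
    (hne : ∀ j : IsLocalRing.ResidueField ℤ_[p], A + j • B ≠ 0)
    (j : IsLocalRing.ResidueField ℤ_[p]) : mu (L j) = 0 :=
  (mu_eq_zero_and_lam_eq_of_red_ne_zero (g := L j) (by rw [hred j]; exact hne j)).1

end Socket

end Summit.BirchSwinnertonDyer.BirchSwinnertonDyer.Theorems.SymbolLineRigidity

end
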